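import Mathlib
import Summits.NavierStokesRegularity.NavierStokesRegularity.Theorems.TaoLadderRungTwoBreakOneShiftWindowK1LinkD
import HarnessLib

/-!
# The one-shift window system, LXII: THE PRECONDITIONER IS INJECTIVE WHEN THE ROW TEST PASSES WITH `Z < 1` —
# `KrawD.wfBoxes` (a cheap Boolean: every box of the residual-slope data is well formed, `0 ≤ RW`) and
# `OneShiftFrame.linOfMatrix_injective_of_check` (Gershgorin: the row sums of `|I − S⁻¹ C [Nb] S|` are `≤ Z < 1`
# for a point matrix in `[Nb]`, so `S⁻¹ C N` is strictly diagonally dominant, `det (C N) ≠ 0`, `det C ≠ 0`, and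
# `linOfMatrix C` is injective on `WState × ℝ`) — the hypothesis `hC` of `windowCertOfMatrix` / `ClausesFor` for the
# replay's preconditioner (cell harvest/h2-tao-ladder, seat p2; rung1/RUNG1-P2G15-REPORT §73; support for K1(1) =
# `NoSurvivingDSSOne`, stmt-NavierStokesRegularity-20205)

MODEL lattice ODEs only; nothing here is a statement about the Navier–Stokes equations; no item is closed; no
instance is evaluated here.
-/

noncomputable section

-- the sub-problem namespace repeats the summit name by design (D-0017)
set_option linter.dupNamespace false

namespace Summit.NavierStokesRegularity.NavierStokesRegularity.Theorems

namespace DSSOneShift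

open Set Finset Metric
open Literature.Analysis.FluidPDE Literature.Analysis.FluidPDE.TaoCascade
open Summit.NavierStokesRegularity.NavierStokesRegularity.Theorems.TaylorModelCert
open Summit.NavierStokesRegularity.NavierStokesRegularity.Theorems.CertificateGlueOn

/-- A well-formed box contains its lower end. [folklore] -/
theorem mem_lo_of_wfD {I : IntervalD} (h : wfD I = true) : IntervalD.mem I.lo.toReal I :=
  ⟨le_rfl, by simpa using (Dyad.ble_iff _ _).1 h⟩

namespace KrawD

variable (k : KrawD)

/-- **Well-formedness of the residual-slope boxes** (`G`, `Gam`, every `Zb`, `Ub`, `Fv`, `Ttop` entry has `lo ≤ hi`;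
`0 ≤ RW`) — a cheap Boolean giving point witnesses inside every box. [folklore] -/
def wfBoxes : Bool :=
  wfD k.rs.G && wfD k.rs.Gam && Dyad.ble (Dyad.ofInt 0) k.rs.RW &&
  ((List.range k.rs.n).all fun q => wfD (IntervalD.aget k.rs.Zb q)) &&
  ((List.range (k.rs.n * k.rs.n)).all fun t => wfD (IntervalD.aget k.rs.Ub t)) &&
  ((List.range k.rs.n).all fun q => wfD (IntervalD.aget k.rs.Fv q)) &&
  ((List.range k.rs.nm).all fun i => wfD (IntervalD.aget k.rs.Ttop i))

/-- What `wfBoxes = true` says. [folklore] -/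
theorem of_wfBoxes (h : k.wfBoxes = true) :
    wfD k.rs.G = true ∧ wfD k.rs.Gam = true ∧ 0 ≤ k.rs.RW.toReal ∧ (∀ q < k.rs.n, wfD (IntervalD.aget k.rs.Zb q) = true) ∧
    (∀ t < k.rs.n * k.rs.n, wfD (IntervalD.aget k.rs.Ub t) = true) ∧ (∀ q < k.rs.n, wfD (IntervalD.aget k.rs.Fv q) = true) ∧
    (∀ i < k.rs.nm, wfD (IntervalD.aget k.rs.Ttop i) = true) := by
  unfold wfBoxes at h
  simp only [Bool.and_eq_true, List.all_eq_true, List.mem_range] at h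
  obtain ⟨⟨⟨⟨⟨⟨h1, h2⟩, h3⟩, h4⟩, h5⟩, h6⟩, h7⟩ := h
  exact ⟨h1, h2, by simpa using (Dyad.ble_iff _ _).1 h3, h4, h5, h6, h7⟩

end KrawD

variable {m : ℕ}

namespace OneShiftFrame

variable (F : OneShiftFrame m)

section Inj

variable {R : ℤ → ℝ} {g : GridD} {kd : KrawD} {e : F.SIdx ≃ Fin g.n}

/-- `coord` determines the point. [folklore] -/
theorem eq_zero_of_coord_eq_zero {x : F.WState × ℝ} (h : ∀ r, F.coord x r = 0) : x = 0 := by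
  refine Prod.ext (funext fun i => funext fun j => ?_) ?_
  · simpa [OneShiftFrame.coord] using h (some (i, j))
  · simpa [OneShiftFrame.coord] using h none

/-- **THE PRECONDITIONER OF A PASSING ROW TEST IS INJECTIVE.** With the frame facts, well-formed boxes, `KrawD.check`
and `ZD < 1`: `linOfMatrix (CmatR …)` has trivial kernel. [cite: Neumaier1991, §3.6–§3.7 (strictly diagonally dominant ⇒ H-matrix ⇒ nonsingular); Tao2016AveragedNS, §5.3; cell vocabulary, harvest/h2-tao-ladder rung1/RUNG1-P2G15-REPORT.md §73] -/
theorem linOfMatrix_injective_of_check (M : F.FrameMatch g kd e R) (hkn : kd.rs.n = g.n)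
    (hwf : kd.wfBoxes = true) (hK : kd.check = true) (hZ1 : Dyad.blt kd.ZD (Dyad.ofInt 1) = true) :
    ∀ x, F.linOfMatrix (kd.CmatR F (e.trans (finCongr hkn.symm))) x = 0 → x = 0 := by
  classical
  set ek : F.SIdx ≃ Fin kd.rs.n := e.trans (finCongr hkn.symm) with hek
  have hekv : ∀ p, (ek p : ℕ) = (e p : ℕ) := fun p => by simp [hek]
  obtain ⟨hG, hGam, hRW, hZb, hUb, hFv, hTt⟩ := kd.of_wfBoxes hwf
  -- point witnesses inside the boxes
  have hn := hkn
  let zlo : Fin m → ℤ → ℝ := fun i kk =>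
    if h : F.InWindow kk then (IntervalD.aget kd.rs.Zb (ek (i, F.widx h))).lo.toReal else 0
  let φlo : Fin m → ℤ → ℝ := fun i kk =>
    if h : F.InWindow kk then (IntervalD.aget kd.rs.Fv (ek (i, F.widx h))).lo.toReal else 0
  let Ulo : Matrix F.SIdx F.SIdx ℝ := fun p q => (IntervalD.aget kd.rs.Ub ((ek q : ℕ) * kd.rs.n + (ek p : ℕ))).lo.toReal
  let Tlo : Fin m → ℝ := fun i => (IntervalD.aget kd.rs.Ttop i).lo.toReal
  have hzmem : ∀ i (j : Fin F.W), IntervalD.mem (zlo i ((j : ℕ) : ℤ)) (IntervalD.aget kd.rs.Zb (ek (i, j))) := by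
    intro i j
    have hin : F.InWindow ((j : ℕ) : ℤ) := ⟨by exact_mod_cast Nat.zero_le _, by exact_mod_cast j.isLt⟩
    have hw : F.widx hin = j := by apply Fin.ext; simp [OneShiftFrame.widx]
    simp only [zlo, dif_pos hin, hw]
    exact mem_lo_of_wfD (hZb _ (ek (i, j)).isLt)
  have hφmem : ∀ i (j : Fin F.W), IntervalD.mem (φlo i ((j : ℕ) : ℤ)) (IntervalD.aget kd.rs.Fv (ek (i, j))) := by
    intro i j
    have hin : F.InWindow ((j : ℕ) : ℤ) := ⟨by exact_mod_cast Nat.zero_le _, by exact_mod_cast j.isLt⟩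
    have hw : F.widx hin = j := by apply Fin.ext; simp [OneShiftFrame.widx]
    simp only [φlo, dif_pos hin, hw]
    exact mem_lo_of_wfD (hFv _ (ek (i, j)).isLt)
  have hUmem : ∀ p q : F.SIdx, IntervalD.mem (Ulo p q) (IntervalD.aget kd.rs.Ub ((ek q : ℕ) * kd.rs.n + (ek p : ℕ))) := by
    intro p q
    refine mem_lo_of_wfD (hUb _ ?_)
    nlinarith [Nat.mul_le_mul_right kd.rs.n (Nat.succ_le_of_lt (ek q).isLt), (ek p).isLt]
  have hTmem : ∀ i : Fin m, IntervalD.mem (Tlo i) (IntervalD.aget kd.rs.Ttop i) := fun i =>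
    mem_lo_of_wfD (hTt i (by rw [M.hm]; exact i.isLt))
  have Mt : kd.rs.Matches F ek M.hW1 M.hDW kd.rs.G.lo.toReal kd.rs.Gam.lo.toReal zlo zlo φlo Ulo (fun _ => 0) Tlo :=
    { hm := M.hm
      hsucc := fun i j => by
        have h := M.hsucc i j
        simp only [hekv]
        convert h using 2
      hmode := fun i j => by rw [hekv]; exact M.hmode i j
      hidx1 := fun i => by rw [hekv]; exact M.hidx1 i
      hidxD := fun i => by rw [hekv]; exact M.hidxD i
      ha := fun i j => by rw [hekv]; exact M.ha i j
      hrτ := M.hrτ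
      hg := mem_lo_of_wfD hG
      hγ := mem_lo_of_wfD hGam
      hz := hzmem
      hz' := hzmem
      hU := hUmem
      hφ := hφmem
      hρ := fun _ => by simpa using hRW
      hT := hTmem }
  obtain ⟨hMag, hrow⟩ := kd.mag_row_of_check F ek Mt hK
  -- the point matrix `N ∈ [Nb]` and the scaled product `A = S⁻¹ C N`
  let N : F.WIdx → F.WIdx → ℝ := fun r c =>
    F.resSlope kd.rs.G.lo.toReal kd.rs.Gam.lo.toReal zlo zlo (F.runSlopeOf (F.slopeOfFlat Ulo) φlo) (fun _ => 0) Tlo r c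
  have hN : ∀ r c, (kd.rs.Nb (kd.rs.eO F ek r) (kd.rs.eO F ek c)).lo.toReal ≤ N r c ∧
      N r c ≤ (kd.rs.Nb (kd.rs.eO F ek r) (kd.rs.eO F ek c)).hi.toReal := fun r c =>
    ⟨(kd.rs.mem_resSlope Mt r c).1, (kd.rs.mem_resSlope Mt r c).2⟩
  have hMagN := hMag N hN
  let Cm : Matrix F.WIdx F.WIdx ℝ := Matrix.of fun r r' => kd.CmatR F ek r r'
  let Nm : Matrix F.WIdx F.WIdx ℝ := Matrix.of N
  let A : Matrix F.WIdx F.WIdx ℝ := Matrix.of fun r c => (∑ r', kd.CmatR F ek r r' * N r' c) / F.bscale r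
  have hZ1r : kd.ZD.toReal < 1 := by simpa using (Dyad.blt_iff _ _).1 hZ1
  -- strict diagonal dominance of `A`
  have hdom : ∀ r, ∑ c ∈ Finset.univ.erase r, ‖A r c‖ < ‖A r r‖ := by
    intro r
    have hdiag : |1 - A r r| ≤ kd.MagR F ek r r := by
      have h := hMagN r r; simp only [if_true] at h; exact h
    have hoff : ∀ c ∈ Finset.univ.erase r, ‖A r c‖ ≤ kd.MagR F ek r c := by
      intro c hc
      have hne : r ≠ c := (Finset.ne_of_mem_erase hc).symm
      have h := hMagN r c
      rw [if_neg hne, zero_sub, abs_neg] at h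
      rw [Real.norm_eq_abs]
      exact h
    have hsum : ∑ c ∈ Finset.univ.erase r, kd.MagR F ek r c + kd.MagR F ek r r = ∑ c, kd.MagR F ek r c :=
      Finset.sum_erase_add _ _ (Finset.mem_univ r)
    have hrr := hrow r
    have h1 : ∑ c ∈ Finset.univ.erase r, ‖A r c‖ ≤ ∑ c ∈ Finset.univ.erase r, kd.MagR F ek r c := Finset.sum_le_sum hoff
    have h2 : 1 - kd.MagR F ek r r ≤ ‖A r r‖ := by
      rw [Real.norm_eq_abs]
      have := abs_sub_abs_le_abs_sub 1 (A r r)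
      rw [abs_one] at this
      linarith [abs_sub_comm 1 (A r r)]
    linarith
  have hdetA : A.det ≠ 0 := det_ne_zero_of_sum_row_lt_diag hdom
  -- `A = diag(1/S) * Cm * Nm`, hence `det Cm ≠ 0`
  have hA : A = Matrix.diagonal (fun r => (F.bscale r)⁻¹) * Cm * Nm := by
    ext r c
    rw [Matrix.mul_assoc, Matrix.diagonal_mul, Matrix.mul_apply]
    simp only [A, Cm, Nm, Matrix.of_apply, div_eq_inv_mul]
  have hdetC : Cm.det ≠ 0 := by
    intro h0
    apply hdetA
    rw [hA, Matrix.det_mul, Matrix.det_mul, h0, mul_zero, zero_mul]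
  -- injectivity
  intro x hx
  have hcoord : ∀ r, F.coord (F.linOfMatrix (kd.CmatR F ek) x) r = 0 := fun r => by rw [hx]; rcases r with _ | ⟨i, j⟩ <;> rfl
  have hmul : Cm.mulVec (F.coord x) = 0 := by
    funext r
    have h := hcoord r
    rw [F.coord_linOfMatrix] at h
    simpa [Cm, Matrix.mulVec, dotProduct, Matrix.of_apply] using h
  have hinj : Function.Injective Cm.mulVec :=
    Matrix.mulVec_injective_iff_isUnit.2 ((Matrix.isUnit_iff_isUnit_det _).2 (isUnit_iff_ne_zero.2 hdetC))
  have hzero : F.coord x = 0 := hinj (by rw [hmul, Matrix.mulVec_zero])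
  exact F.eq_zero_of_coord_eq_zero fun r => congrFun hzero r

end Inj

end OneShiftFrame

end DSSOneShift

end Summit.NavierStokesRegularity.NavierStokesRegularity.Theorems
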